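import Summits.AtomisticToContinuum.FouriersLaw.Theses.CageBudgetFekete
import Summits.AtomisticToContinuum.FouriersLaw.Theorems.CageBudgetFeketeHeatVarianceCeilingBlockVariance
import Summits.AtomisticToContinuum.FouriersLaw.Theorems.CageBudgetFeketeHeatVarianceCeilingStaticFoelner
import Summits.AtomisticToContinuum.FouriersLaw.Theorems.CageBudgetFeketeHeatVarianceCeilingCoboundaryInequality
import HarnessLib

/-!
# The certificate bound of line `dual-certificate` (crux `CageBudgetFekete.HeatVarianceCeiling`,
item stmt-AtomisticToContinuum-15770; `--supports` file, closes nothing; line lead, 2026-08-17)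

WHAT. The transfer theorem of the line, now sorry-free because its three infrastructure stubs have
landed (`stub_blockVariance` p161208, `stub_coboundaryInequality` p163147, `stub_staticFoelner` p162846):
in the arena of the route (the infinite pinned chain `pinnedChain ω₂ lam β γ`, `ω₂, lam, β > 0`, a shift-
and reversal-invariant DLR state `μ` at `T > 0`, a `μ`-preserving shift-covariant dynamics `D` with
absolutely convergent, continuous summed current autocorrelation `C`), the equilibrium heat variance
`V(τ) = 2∫_{(0,τ]}(τ−s)C(s)ds` is bounded by EVERY bounded `C¹` local test observable `u`
(an "approximate Helfand potential"):

  `V(τ) ≤ (2·⟪u⟫ + τ·⟪j₀ − 𝒜u⟫)²`,  `⟪f⟫² := Σ_{x∈ℤ} Cov_μ(f, f∘τ_x)`  (`heatVariance_le_certificate`),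

for every `τ ≥ 0`; here `𝒜 = liouvilleZ` is the Liouville operator and `⟪·⟫` the zero-wavenumber
seminorm, a purely STATIC quantity (two sums of Gibbs covariances). Consequently the crux
`HeatVarianceCeiling` follows from the one remaining registered stub of the line, the static
certificate family `stub_staticCertificates` (`⟪u_τ⟫² ≤ Mτ`, `⟪j₀ − 𝒜u_τ⟫² ≤ M/τ` for `τ ≥ 1`), with
`B = 9·max(M,0)`, `τ₁ = 1` (`heatVarianceCeiling_of_staticCertificates`; the hypothesis is the stub's
registered statement written out, NOT a named fact).

HOW. `n⁻¹ × stub_coboundaryInequality` reads `a_n ≤ (2√(n⁻¹Var A_n u) + τ√(n⁻¹Var A_n r))²`;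
`stub_blockVariance` gives `a_n → V(τ)`, `stub_staticFoelner` gives the right side `→ (2⟪u⟫ + τ⟪r⟫)²`;
limits preserve `≤`. The Thomson/dual reading: `V(τ)` is (Fejér-)comparable to
`τ·inf_u{τ⟪j₀−𝒜u⟫² + τ⁻¹⟪u⟫²}`, the `K`-functional of `[j₀]` between Doyon's `ℋ₀` and the graph space of the
Liouvillian, so a ceiling `V ≤ Bτ` is an upper bound on an infimum and is proved by EXHIBITING `u`.
[cite: Helfand1960] [cite: DeRoeckHuveneers2015, §2.3 Thm 1] [cite: Doyon2022, Lemma 4.5]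
-/

noncomputable section

namespace Summit.AtomisticToContinuum.FouriersLaw.Theorems.HeatVarianceCeiling.DualCertificate

open MeasureTheory Filter Set Function
open scoped Topology BigOperators
open Literature.MathematicalPhysics.KineticTheory.HeatConduction

/-- Normalising the finite-`n` inequality: for `w ≥ 0`,
`w · (2√p + τ√q)² = (2√(w p) + τ√(w q))²`. [folklore] -/
theorem cert_scale_sq {w p q τ : ℝ} (hw : 0 ≤ w) :
    w * (2 * Real.sqrt p + τ * Real.sqrt q) ^ 2 =
      (2 * Real.sqrt (w * p) + τ * Real.sqrt (w * q)) ^ 2 := by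
  rw [Real.sqrt_mul hw, Real.sqrt_mul hw]
  have : w = Real.sqrt w ^ 2 := (Real.sq_sqrt hw).symm
  conv_lhs => rw [this]
  ring

/-- The arithmetic of the certificate: with `c ≥ 0`, `τ ≥ 1`, `a ≤ cτ`, `b ≤ c/τ`:
`(2√a + τ√b)² ≤ 9cτ`. [folklore] -/
theorem cert_arith {a b c τ : ℝ} (hc : 0 ≤ c) (hτ : 1 ≤ τ) (ha : a ≤ c * τ)
    (hb : b ≤ c / τ) : (2 * Real.sqrt a + τ * Real.sqrt b) ^ 2 ≤ 9 * c * τ := by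
  have hτ0 : 0 < τ := by linarith
  have h1 : Real.sqrt a ≤ Real.sqrt (c * τ) := Real.sqrt_le_sqrt ha
  have h2 : Real.sqrt b ≤ Real.sqrt (c / τ) := Real.sqrt_le_sqrt hb
  have h3 : τ * Real.sqrt (c / τ) = Real.sqrt (c * τ) := by
    have : τ = Real.sqrt (τ ^ 2) := (Real.sqrt_sq hτ0.le).symm
    conv_lhs => rw [this]
    rw [← Real.sqrt_mul (sq_nonneg τ)]
    congr 1
    rw [Real.sqrt_sq hτ0.le]
    field_simp
  have h4 : 2 * Real.sqrt a + τ * Real.sqrt b ≤ 3 * Real.sqrt (c * τ) := by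
    have : τ * Real.sqrt b ≤ τ * Real.sqrt (c / τ) := mul_le_mul_of_nonneg_left h2 hτ0.le
    linarith
  have h5 : 0 ≤ 2 * Real.sqrt a + τ * Real.sqrt b := by positivity
  calc (2 * Real.sqrt a + τ * Real.sqrt b) ^ 2 ≤ (3 * Real.sqrt (c * τ)) ^ 2 :=
        pow_le_pow_left₀ h5 h4 2
    _ = 9 * c * τ := by
        rw [mul_pow, Real.sq_sqrt (by positivity)]
        ring

/-- **The certificate bound (transfer theorem of line `dual-certificate`).** In the arena of route
`CageBudgetFekete` (pinned chain `pinnedChain ω₂ lam β γ`, `ω₂, lam, β > 0`; shift- and reversal-invariant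
DLR state `μ` at `T > 0`; `μ`-preserving shift-covariant dynamics `D` with absolutely convergent, continuous
summed current autocorrelation), for EVERY bounded `C¹` local test observable `u` and every `τ ≥ 0`:
`2∫_{(0,τ]}(τ−s)C(s)ds ≤ (2√⟪u,u⟫ + τ√⟪r,r⟫)²` with `r = j₀ − 𝒜u`, `𝒜 = liouvilleZ`, and
`⟪f,f⟫ = Σ_{x∈ℤ}(∫ f·(f∘τ_x)dμ − (∫f dμ)²)` the zero-wavenumber bracket (written as a `tsum`; it converges
for these `f`). The heat variance is bounded by any approximate Helfand potential; no decay, mixing in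
time or spectral input is used. [cite: Helfand1960] [cite: DeRoeckHuveneers2015, §2.3 Thm 1] -/
theorem heatVariance_le_certificate :
    ∀ ω₂ lam β γ : ℝ, 0 < ω₂ → 0 < lam → 0 < β → ∀ T : ℝ, 0 < T → ∀ μ : MeasureTheory.Measure Literature.MathematicalPhysics.KineticTheory.HeatConduction.ChainConfig, (Literature.MathematicalPhysics.KineticTheory.HeatConduction.pinnedChain ω₂ lam β γ).IsChainGibbsMeasure T μ → Literature.MathematicalPhysics.KineticTheory.HeatConduction.IsShiftInvariant μ → μ.map (fun σ : Literature.MathematicalPhysics.KineticTheory.HeatConduction.ChainConfig => fun x : ℤ => ((σ x).1, -(σ x).2)) = μ → ∀ D : Literature.MathematicalPhysics.KineticTheory.HeatConduction.InfiniteChainDynamics (Literature.MathematicalPhysics.KineticTheory.HeatConduction.pinnedChain ω₂ lam β γ), D.PreservesMeasure μ → (∀ t : ℝ, ∀ᵐ σ ∂μ, D.flow t (Literature.MathematicalPhysics.KineticTheory.HeatConduction.shift σ) = Literature.MathematicalPhysics.KineticTheory.HeatConduction.shift (D.flow t σ)) → (∀ t : ℝ, D.HasAbsConvergentCorrelation μ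 t) → Continuous (fun t : ℝ => D.currentCorrelation μ t) → ∀ u : Literature.MathematicalPhysics.KineticTheory.HeatConduction.ChainConfig → ℝ, Literature.MathematicalPhysics.KineticTheory.HeatConduction.IsLocalTestFunction u → ∀ τ : ℝ, 0 ≤ τ → 2 * ∫ s in Set.Ioc (0:ℝ) τ, (τ - s) * D.currentCorrelation μ s ≤ (2 * Real.sqrt (∑' x : ℤ, ((∫ σ, u σ * u (fun i => σ (i + x)) ∂μ) - (∫ σ, u σ ∂μ) * (∫ σ, u σ ∂μ))) + τ * Real.sqrt (∑' x : ℤ, ((∫ σ, ((Literature.MathematicalPhysics.KineticTheory.HeatConduction.pinnedChain ω₂ lam β γ).bondCurrentZ σ 0 - Literature.MathematicalPhysics.KineticTheory.HeatConduction.liouvilleZ (Literature.MathematicalPhysics.KineticTheory.HeatConduction.pinnedChain ω₂ lam β γ) u σ) * ((Literature.MathematicalPhysics.KineticTheory.HeatConduction.pinnedChain ω₂ lam β γ).bondCurrentZ (fun i => σ (i + x)) 0 - Literature.MathematicalPhysics.KineticTheory.HeatConduction.liouvilleZ (Literature.MathematicalPhysics.KineticTheory.HeatConduction.pinnedChain ω₂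 lam β γ) u (fun i => σ (i + x))) ∂μ) - (∫ σ, ((Literature.MathematicalPhysics.KineticTheory.HeatConduction.pinnedChain ω₂ lam β γ).bondCurrentZ σ 0 - Literature.MathematicalPhysics.KineticTheory.HeatConduction.liouvilleZ (Literature.MathematicalPhysics.KineticTheory.HeatConduction.pinnedChain ω₂ lam β γ) u σ) ∂μ) * (∫ σ, ((Literature.MathematicalPhysics.KineticTheory.HeatConduction.pinnedChain ω₂ lam β γ).bondCurrentZ σ 0 - Literature.MathematicalPhysics.KineticTheory.HeatConduction.liouvilleZ (Literature.MathematicalPhysics.KineticTheory.HeatConduction.pinnedChain ω₂ lam β γ) u σ) ∂μ)))) ^ 2 := by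
  intro ω₂ lam β γ hω hl hβ T hT μ hG hSI hR D hP hSh hAC hCc u hu τ hτ0
  -- S1: a_n → V(τ)
  have hlimA := stub_blockVariance ω₂ lam β γ hω hl hβ T hT μ hG hSI hR D hP hSh hAC hCc τ hτ0
  -- S3: b_n → (2√⟪u⟫² + τ√⟪r⟫²)²
  have h3' := stub_staticFoelner ω₂ lam β γ hω hl hβ T hT μ hG hSI hR u hu
  dsimp only at h3'
  obtain ⟨hFu, hFr⟩ := h3'
  have hlimB := ((hFu.sqrt.const_mul 2).add (hFr.sqrt.const_mul τ)).pow 2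
  -- S2: a_n ≤ b_n at every n, then pass to the limit
  exact le_of_tendsto_of_tendsto' hlimA hlimB (fun n => by
    have h2' := stub_coboundaryInequality ω₂ lam β γ hω hl hβ T hT μ hG hSI hR D hP hSh hAC hCc u hu τ hτ0 n
    have hw : 0 ≤ (n : ℝ)⁻¹ := inv_nonneg.2 (Nat.cast_nonneg n)
    have h2'' := mul_le_mul_of_nonneg_left h2' hw
    rw [cert_scale_sq hw] at h2''
    exact h2'')

/-- **The crux from static certificates.** If for every admissible parameter point and every shift- and
reversal-invariant DLR state of the pinned chain there are `M` and, for every scale `τ ≥ 1`, a bounded `C¹`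
local test observable `u_τ` with `⟪u_τ,u_τ⟫ ≤ Mτ` and `⟪j₀ − 𝒜u_τ, j₀ − 𝒜u_τ⟫ ≤ M/τ` (the registered stub
`stub_staticCertificates` of line `dual-certificate`, written out as the hypothesis), then
`CageBudgetFekete.HeatVarianceCeiling` holds, with `B = 9·max(M,0)` and `τ₁ = 1`. The hypothesis is the
finiteness half of Fourier's law for the closed chain in static (Thomson) form — open; this theorem is
the kernel-checked reduction, not a proof of the crux. [cite: Helfand1960] [cite: Doyon2022, Lemma 4.5] -/
theorem heatVarianceCeiling_of_staticCertificates
    (hS4 : ∀ ω₂ lam β γ : ℝ, 0 < ω₂ → 0 < lam → 0 < β → ∀ T : ℝ, 0 < T → ∀ μ : MeasureTheory.Measure Literature.MathematicalPhysics.KineticTheory.HeatConduction.ChainConfig, (Literature.MathematicalPhysics.KineticTheory.HeatConduction.pinnedChain ω₂ lam β γ).IsChainGibbsMeasure T μ → Literature.MathematicalPhysics.KineticTheory.HeatConduction.IsShiftInvariant μ → μ.map (fun σ : Literature.MathematicalPhysics.KineticTheory.HeatConduction.ChainConfig => fun x : ℤ => ((σ x).1, -(σ x).2)) = μ →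
      ∃ M : ℝ, ∀ τ : ℝ, 1 ≤ τ →
        ∃ u : Literature.MathematicalPhysics.KineticTheory.HeatConduction.ChainConfig → ℝ,
          Literature.MathematicalPhysics.KineticTheory.HeatConduction.IsLocalTestFunction u ∧
          (∑' x : ℤ, ((∫ σ, u σ * u (fun i => σ (i + x)) ∂μ) - (∫ σ, u σ ∂μ) * (∫ σ, u σ ∂μ))) ≤ M * τ ∧
          (∑' x : ℤ, ((∫ σ, ((Literature.MathematicalPhysics.KineticTheory.HeatConduction.pinnedChain ω₂ lam β γ).bondCurrentZ σ 0 - Literature.MathematicalPhysics.KineticTheory.HeatConduction.liouvilleZ (Literature.MathematicalPhysics.KineticTheory.HeatConduction.pinnedChain ω₂ lam β γ) u σ) * ((Literature.MathematicalPhysics.KineticTheory.HeatConduction.pinnedChain ω₂ lam β γ).bondCurrentZ (fun i => σ (i + x)) 0 - Literature.MathematicalPhysics.KineticTheory.HeatConduction.liouvilleZ (Literature.MathematicalPhysics.KineticTheory.HeatConduction.pinnedChain ω₂ lam β γ) u (fun i => σ (i + x))) ∂μ) - (∫ σ, ((Literature.MathematicalPhysics.KineticTheory.HeatConduction.pinnedChain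 ω₂ lam β γ).bondCurrentZ σ 0 - Literature.MathematicalPhysics.KineticTheory.HeatConduction.liouvilleZ (Literature.MathematicalPhysics.KineticTheory.HeatConduction.pinnedChain ω₂ lam β γ) u σ) ∂μ) * (∫ σ, ((Literature.MathematicalPhysics.KineticTheory.HeatConduction.pinnedChain ω₂ lam β γ).bondCurrentZ σ 0 - Literature.MathematicalPhysics.KineticTheory.HeatConduction.liouvilleZ (Literature.MathematicalPhysics.KineticTheory.HeatConduction.pinnedChain ω₂ lam β γ) u σ) ∂μ))) ≤ M / τ) :
    Summit.AtomisticToContinuum.FouriersLaw.Theses.CageBudgetFekete.HeatVarianceCeiling := by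
  intro ω₂ lam β γ hω hl hβ T hT μ hG hSI hR D hP hSh hAC hCc V hV
  obtain ⟨M, hM⟩ := hS4 ω₂ lam β γ hω hl hβ T hT μ hG hSI hR
  refine ⟨9 * max M 0, 1, fun τ hτ => ?_⟩
  subst hV
  show 2 * ∫ s in Set.Ioc (0:ℝ) τ, (τ - s) * D.currentCorrelation μ s ≤ 9 * max M 0 * τ
  have hτ0 : 0 ≤ τ := by linarith
  obtain ⟨u, hu, hbu, hbr⟩ := hM τ hτ
  refine (heatVariance_le_certificate ω₂ lam β γ hω hl hβ T hT μ hG hSI hR D hP hSh hAC hCc u hu τ hτ0).trans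
    (cert_arith (le_max_right M 0) hτ ?_ ?_)
  · exact hbu.trans (mul_le_mul_of_nonneg_right (le_max_left M 0) hτ0)
  · exact hbr.trans (div_le_div_of_nonneg_right (le_max_left M 0) (by linarith))

end Summit.AtomisticToContinuum.FouriersLaw.Theorems.HeatVarianceCeiling.DualCertificate

end
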